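import Summits.HodgeConjecture.HodgeConjecture.Theses.HolomorphicityRate
import Literature.AlgebraicGeometry.HodgeTheory.HardLefschetzNFoldHolds
import Literature.AlgebraicTopology.SingularHomology.CupProductProofs
import HarnessLib

/-!
# Route `HolomorphicityRate`, item `PolarisedLefschetzData` (stmt-HodgeConjecture-18026)

Anti-vacuity of the pin of the route (shared verbatim with route `GmtVisibleFractionBootstrap`):
every smooth projective complex `n`-fold `X` carries a hard-Lefschetz datum
`Λ : HardLefschetzNFold n X` whose class `h = Λ.hyperplaneClass` is KÄHLER (`IsKaehlerClass n X h`)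
and all of whose cup powers `hᵖ = cupPowTwo h p` are algebraic (`∈ algebraicClasses X p = Nᵖ H²ᵖ`).

Proof (all inputs are proved tree theorems, nothing named or conditional):

* choose a projective embedding `ι : X ⟶ ℙᴺ` (`IsSmoothProjective.isProjectiveOver`), a Hodge
  model `A` (`nonempty_hodgeModel_holds`), a natural multiplicative real de Rham family `e`
  (`exists_deRhamIsoFamily_holds`) and the class `H ∈ H²(X(ℂ); ℂ)` with `A^* H = e[θ_ι] ⊗ 1`,
  `θ_ι` the restricted Fubini–Study form (`HodgeModel.pullback_surjective`);
* `H` is Kähler for `(A, e)` (`HodgeModel.isKaehlerClassVia_of_pullback_eq_fubiniStudyPullbackForm`,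
  Voisin I §3.3.2 Lemma 3.16), and a POSITIVE REAL multiple `r • H` is rational
  (`exists_pos_smul_isRationalClass_of_pullback_eq_fubiniStudy`, Voisin I Thm. 7.10);
* `r • H` is the class of a hard-Lefschetz datum `Λ`
  (`HodgeModel.exists_hardLefschetzNFold_of_pullback_eq_fubiniStudy_smul`, Voisin I Thm. 6.25,
  Rem. 6.27, Voisin II Prop. 9.20), and is Kähler (`IsKaehlerClassVia.smul_of_pos`,
  `IsKaehlerClassVia.isKaehlerClass`);
* `hᵖ ∈ Nᵖ` for EVERY hard-Lefschetz datum, by induction on `p`: `h⁰ = 1 ∈ N⁰ = ⊤`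
  (`algebraicClasses_zero`), and `hᵖ⁺¹ = hᵖ ∪ h = h ∪ hᵖ = L hᵖ` (graded commutativity in even
  degree, `cupProduct_gradedComm_holds`) lies in `Nᵖ⁺¹` by the datum's field
  `lefschetzOperator_mem_algebraicClasses` (Voisin II Prop. 9.20: `[H] ∪ [Z] = [H · Z]`).

## References

* [VoisinHodgeI2002] C. Voisin, Hodge Theory and Complex Algebraic Geometry I (CUP 2002), §3.3.2
  Lemma 3.16, Thm. 6.25, Rem. 6.27, §7.1.2, Thm. 7.10.
* [VoisinHodgeII2003] C. Voisin, Hodge Theory and Complex Algebraic Geometry II (CUP 2003), §9.2.4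
  Prop. 9.20.
* [HatcherAT2002] A. Hatcher, Algebraic Topology (CUP 2002), §3.2 and Thm. 3.11.
-/

noncomputable section

open scoped Manifold

-- `Summit.HodgeConjecture.HodgeConjecture.Theorems` is the mandated namespace (single-problem summit:
-- Problem = Summit), which `linter.dupNamespace` flags on every declaration; the lakefile turns the
-- linter off tree-wide (weak option), restated here so stand-alone elaboration is warning-free too.
set_option linter.dupNamespace false

namespace Summit.HodgeConjecture.HodgeConjecture.Theorems

open CategoryTheory AlgebraicGeometry
open Literature.AlgebraicTopology.SingularHomology Literature.Geometry.Kaehler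
open Literature.NumberTheory.Transcendental
open Literature.AlgebraicGeometry.Motives (IsSmoothProjective)
open Literature.AlgebraicGeometry.Motives.AnalytificationKaehler (fubiniStudyPullbackForm)
open Literature.AlgebraicGeometry.HodgeTheory

variable {n : ℕ} {X : Literature.AlgebraicGeometry.Motives.SchemeOver ℂ}

/-- `hᵖ⁺¹ = L_h (hᵖ)`: the next cup power of a degree-`2` class is its Lefschetz operator applied to
the previous one (`hᵖ⁺¹ = hᵖ ∪ h = h ∪ hᵖ`, even-degree classes commute, Hatcher Thm. 3.11).
[cite: HatcherAT2002, §3.2 and Thm. 3.11] -/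
theorem cupPowTwo_succ_eq_lefschetzOperator {Y : Type} [TopologicalSpace Y]
    (h : singularCohomology ℂ ℂ Y 2) (p : ℕ) :
    cupPowTwo h (p + 1) = lefschetzOperator h (two_add_two_mul p) (cupPowTwo h p) := by
  rw [cupPowTwo_succ, lefschetzOperator_apply,
    cupProduct_gradedComm_holds ℂ Y (two_mul_add_two p) (two_add_two_mul p) (cupPowTwo h p) h]
  simp [pow_mul]

/-- **The cup powers of the class of a hard-Lefschetz datum are algebraic**: `hᵖ ∈ Nᵖ H²ᵖ(X(ℂ); ℂ)`
for every `p` (`h⁰ = 1 ∈ N⁰ = ⊤`; `hᵖ⁺¹ = L_h hᵖ` and `L_h` moves `Nᵖ` into `Nᵖ⁺¹`,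
Voisin II Prop. 9.20). [cite: VoisinHodgeII2003, §9.2.4 Prop. 9.20] -/
theorem cupPowTwo_hyperplaneClass_mem_algebraicClasses (Λ : HardLefschetzNFold n X) (p : ℕ) :
    cupPowTwo Λ.hyperplaneClass p ∈ algebraicClasses X p := by
  induction p with
  | zero =>
    rw [algebraicClasses_zero]
    exact Submodule.mem_top
  | succ p ih =>
    rw [cupPowTwo_succ_eq_lefschetzOperator]
    exact Λ.lefschetzOperator_mem_algebraicClasses p _ ih

/-- **Every smooth projective complex `n`-fold carries a hard-Lefschetz datum with KÄHLER class**: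
the datum of a rational positive real multiple `r • [θ_ι]` of the hyperplane-type class of a
projective embedding `ι : X ⟶ ℙᴺ`. [cite: VoisinHodgeI2002, §3.3.2 Lemma 3.16, Thm. 6.25, Rem. 6.27 and Thm. 7.10]
[cite: VoisinHodgeII2003, §9.2.4 Prop. 9.20] -/
theorem exists_hardLefschetzNFold_isKaehlerClass (hX : IsSmoothProjective n X) :
    ∃ Λ : HardLefschetzNFold n X, IsKaehlerClass n X Λ.hyperplaneClass := by
  obtain ⟨N, ι, hι⟩ := hX.isProjectiveOver
  obtain ⟨A⟩ := (nonempty_hodgeModel_holds (n := n) (X := X)).nonempty hX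
  obtain ⟨e, he, hem, -⟩ := exists_deRhamIsoFamily_holds A.model
  have hθ := A.fubiniStudyPullbackForm_mem_closedSmoothForms ι
  obtain ⟨H, hH⟩ := A.pullback_surjective 2 (ofRealClass A.carrier 2 (e A.carrier 2
    (deRhamCohomology.mk ⟨fubiniStudyPullbackForm A.model ι A.toComplexPoints, hθ⟩)))
  have hK : A.IsKaehlerClassVia e H :=
    A.isKaehlerClassVia_of_pullback_eq_fubiniStudyPullbackForm e hX ι hθ hH
  obtain ⟨r, hr, hrat⟩ := exists_pos_smul_isRationalClass_of_pullback_eq_fubiniStudy hX A ι e he hθ hH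
  have hr0 : (r : ℂ) ≠ 0 := Complex.ofReal_ne_zero.2 hr.ne'
  obtain ⟨Λ, hΛ⟩ :=
    A.exists_hardLefschetzNFold_of_pullback_eq_fubiniStudy_smul ι e hX he hem hθ hH hr0 hrat
  refine ⟨Λ, ?_⟩
  rw [hΛ]
  exact (hK.smul_of_pos hr).isKaehlerClass he hem

/-- The statement of the item in unfolded form (shared verbatim by the routes `HolomorphicityRate`
and `GmtVisibleFractionBootstrap`): every smooth projective complex `n`-fold carries a hard-Lefschetz
datum whose class is Kähler and all of whose cup powers are algebraic.
[cite: VoisinHodgeI2002, Thm. 6.25, Rem. 6.27, §7.1.2 and Thm. 7.10] [cite: VoisinHodgeII2003, §9.2.4 Prop. 9.20] -/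
theorem polarisedLefschetzData (n : ℕ) (X : Literature.AlgebraicGeometry.Motives.SchemeOver ℂ)
    (hX : IsSmoothProjective n X) :
    ∃ Λ : HardLefschetzNFold n X, IsKaehlerClass n X Λ.hyperplaneClass ∧
      ∀ p : ℕ, cupPowTwo Λ.hyperplaneClass p ∈ algebraicClasses X p := by
  obtain ⟨Λ, hΛ⟩ := exists_hardLefschetzNFold_isKaehlerClass hX
  exact ⟨Λ, hΛ, cupPowTwo_hyperplaneClass_mem_algebraicClasses Λ⟩

/-- **`PolarisedLefschetzData` holds** (item stmt-HodgeConjecture-18026 of route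
`HolomorphicityRate`). [cite: VoisinHodgeI2002, Thm. 6.25, Rem. 6.27, §7.1.2 and Thm. 7.10]
[cite: VoisinHodgeII2003, §9.2.4 Prop. 9.20] -/
theorem polarisedLefschetzData_proof :
    Summit.HodgeConjecture.HodgeConjecture.Theses.HolomorphicityRate.PolarisedLefschetzData := by
  unfold Summit.HodgeConjecture.HodgeConjecture.Theses.HolomorphicityRate.PolarisedLefschetzData
  exact polarisedLefschetzData

end Summit.HodgeConjecture.HodgeConjecture.Theorems

end
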